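import Mathlib.GroupTheory.Nilpotent
import Summits.MatrixMultiplication.OmegaCensus.BoxBadOddPGroups

/-!
# ω-census, family (b3): conjecture C9 — a box-useful finite group has ABELIAN odd Sylow subgroups; nilpotent groups of odd order

HONEST FRAMING (pub-omega census; verbatim): lottery ticket; floor = certified bounds/negative ranges.
Census BOOKKEEPING (conjecture C9 of the cell; pub-omega kernel-l4 gen 14, corollary of task K-3).  Combining the classification-free
theorem `OddPGroup.not_boxUseful_of_isPGroup` (a non-abelian finite `p`-group of odd order is not box-useful, `BoxBadOddPGroups`) with
C9 (a) — box-usefulness passes to subgroups, to sources of embeddings and to homomorphic images (`BoxUseful.subgroup`,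
`BoxUseful.of_injective`, `BoxUseful.of_surjective`) — gives a NECESSARY CONDITION for box-usefulness of an ARBITRARY finite group:
* `not_boxUseful_of_odd_pSubgroup`: a finite group with a non-abelian `p`-subgroup, `p` an odd prime, is NOT box-useful;
* **`sylow_comm_of_boxUseful`**: in a box-useful finite group every Sylow `p`-subgroup with `p` odd is abelian;
* `not_boxUseful_of_injective_odd_pGroup` / `not_boxUseful_of_surjective_odd_pGroup`: no finite group receiving an embedding of, or
  mapping onto, a non-abelian `p`-group of odd order is box-useful;
* **`comm_of_boxUseful_of_isNilpotent`**: a box-useful NILPOTENT group of odd order is abelian (it is the direct product of its Sylow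
  subgroups, `Group.isNilpotent_of_finite_tfae`, each abelian by the above) — C9 (b) HOLDS on all nilpotent groups of odd order
  (`center_index_eq_one_of_boxUseful_of_isNilpotent`).
This is consistent with C9 (b) (`BoxRatioSectionLaw`): the four predicted classes (abelian; centre index `4`; centre index `6`; the
`𝒞₂` package `C₃² ⋊_ε C`) all have abelian odd Sylow subgroups.  Nothing here is progress on `ω`.
-/

namespace Summit.MatrixMultiplication.OmegaCensus

open Finset ProductBoxBound

namespace OddPGroup

variable {G : Type*} [Group G] [Fintype G] [DecidableEq G] {p : ℕ} [hp : Fact p.Prime]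

/-- **A finite group with a non-abelian `p`-subgroup (`p` odd) is not box-useful** (`OddPGroup.not_boxUseful_of_isPGroup` on the
subgroup + C9 (a) `BoxUseful.subgroup`). [folklore] -/
theorem not_boxUseful_of_odd_pSubgroup (hodd : Odd p) (H : Subgroup G) (hH : IsPGroup p H)
    (hna : ∃ a ∈ H, ∃ b ∈ H, a * b ≠ b * a) : ¬ BoxUseful G := by
  classical
  intro hG
  obtain ⟨a, ha, b, hb, hab⟩ := hna
  have hna' : ∃ x y : H, x * y ≠ y * x :=
    ⟨⟨a, ha⟩, ⟨b, hb⟩, fun h => hab (by simpa using congrArg Subtype.val h)⟩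
  exact not_boxUseful_of_isPGroup hodd hH hna' (hG.subgroup H)

/-- **In a box-useful finite group every Sylow `p`-subgroup with `p` odd is abelian.** [folklore] -/
theorem sylow_comm_of_boxUseful (hodd : Odd p) (h : BoxUseful G) (P : Sylow p G) (a b : G) (ha : a ∈ (P : Subgroup G))
    (hb : b ∈ (P : Subgroup G)) : a * b = b * a := by
  by_contra hab
  exact not_boxUseful_of_odd_pSubgroup hodd (P : Subgroup G) P.isPGroup' ⟨a, ha, b, hb, hab⟩ h

/-- **In a box-useful finite group every `p`-subgroup with `p` odd is abelian.** [folklore] -/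
theorem pSubgroup_comm_of_boxUseful (hodd : Odd p) (h : BoxUseful G) (H : Subgroup G) (hH : IsPGroup p H) (a b : G)
    (ha : a ∈ H) (hb : b ∈ H) : a * b = b * a := by
  by_contra hab
  exact not_boxUseful_of_odd_pSubgroup hodd H hH ⟨a, ha, b, hb, hab⟩ h

/-- No finite group receiving an EMBEDDING of a non-abelian `p`-group of odd order is box-useful. [folklore] -/
theorem not_boxUseful_of_injective_odd_pGroup {K : Type*} [Group K] [Fintype K] [DecidableEq K] (hodd : Odd p)
    (hK : IsPGroup p K) (hna : ∃ a b : K, a * b ≠ b * a) (f : K →* G) (hf : Function.Injective f) : ¬ BoxUseful G :=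
  fun hG => not_boxUseful_of_isPGroup hodd hK hna (BoxUseful.of_injective f hf hG)

/-- No finite group MAPPING ONTO a non-abelian `p`-group of odd order is box-useful. [folklore] -/
theorem not_boxUseful_of_surjective_odd_pGroup {K : Type*} [Group K] [Fintype K] [DecidableEq K] (hodd : Odd p)
    (hK : IsPGroup p K) (hna : ∃ a b : K, a * b ≠ b * a) (f : G →* K) (hf : Function.Surjective f) : ¬ BoxUseful G :=
  fun hG => not_boxUseful_of_isPGroup hodd hK hna (BoxUseful.of_surjective f hf hG)

omit hp in
/-- **A box-useful NILPOTENT group of odd order is abelian**: it is the direct product of its Sylow subgroups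
(`Group.isNilpotent_of_finite_tfae`), all of odd order hence abelian (`sylow_comm_of_boxUseful`). [folklore] -/
theorem comm_of_boxUseful_of_isNilpotent [Group.IsNilpotent G] (hodd : Odd (Fintype.card G)) (h : BoxUseful G) (x y : G) :
    x * y = y * x := by
  classical
  obtain ⟨e⟩ := ((Group.isNilpotent_of_finite_tfae (G := G)).out 0 4 rfl rfl).mp ‹_›
  have key : e.symm x * e.symm y = e.symm y * e.symm x := by
    funext q P
    haveI : Fact (Nat.Prime (q : ℕ)) := ⟨Nat.prime_of_mem_primeFactors q.2⟩
    have hqodd : Odd (q : ℕ) := by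
      refine hodd.of_dvd_nat ?_
      rw [← Nat.card_eq_fintype_card]
      exact Nat.dvd_of_mem_primeFactors q.2
    apply Subtype.ext
    simp only [Pi.mul_apply, Subgroup.coe_mul]
    exact sylow_comm_of_boxUseful hqodd h P _ _ ((e.symm x) q P).2 ((e.symm y) q P).2
  simpa using congrArg e key

omit hp in
/-- **C9 (b) holds on nilpotent groups of odd order**: a box-useful one has centre of index `1`. [folklore] -/
theorem center_index_eq_one_of_boxUseful_of_isNilpotent [Group.IsNilpotent G] (hodd : Odd (Fintype.card G)) (h : BoxUseful G) :
    (Subgroup.center G).index = 1 := by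
  rw [Subgroup.index_eq_one, eq_top_iff]
  intro z _
  rw [Subgroup.mem_center_iff]
  intro g
  exact comm_of_boxUseful_of_isNilpotent hodd h g z

end OddPGroup

end Summit.MatrixMultiplication.OmegaCensus
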